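import Summits.Ventures.HodgeRepro.DihedralQuad

/-!
# The dihedral rectangle: `k` even is EMPTY, and the threshold `8k` is SHARP — a kernel iff

Blind re-derivation cell `pub-hodge-repro`, seat `p1` (gen 11).  The two remaining halves of route-2 g30's
«Theorem A» (INBOX L1130) for the dihedral rectangle `Φ, Φs, Φt, Φ(st)` (`s, t` involutions, `st` of order `2k`,
`(st)^k = c`):

* `rmul_s_eq_smul_of_even` — `k` EVEN: EVERY `SumTwo` quadruple has `Φs = c • Φ` (a conjugate pair), in any `G`;
* `eight_mul_le_card_of_dihedralQuad` — a `SumTwo` quadruple without a conjugate pair forces `8k ≤ |G|`;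
* `exists_dihedralQuad_iff` — for `k ≥ 3` odd the mechanism exists IFF `8k ≤ |G|`.

Everything rests on the ROW SUMS `S(x) = 1_Φ(x) + 1_Φ(xs)` over the `s`-cosets: `S(xs) = S(x)`, the local `SumTwo`
at `x` reads `S(x) + S(xt) = 2`, hence `S(x) + S(x · st) = 2` (`rowS_add_rowS_mul_st`), so `S` has period `2` along
every `⟨st⟩`-orbit (`rowS_mul_pow_two`); the CM condition reads `S(xc) = 2 − S(x)` (`rowS_mul_conj`).  For `k` even
`S(x · (st)^k) = S(x)` and `= 2 − S(x)` force `S ≡ 1`, i.e. `1_Φ(xs) = 1 − 1_Φ(x) = 1_Φ(xc)`: `Φs = c • Φ`.  Below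
`8k` Lagrange makes `G = ⟨s, t⟩ = D_{2k}` (the injective `dihedralRectHom`), every `x` is `(st)^a` or `(st)^a s`, and
`T(a) = S((st)^a)` satisfies `T(a) + T(a+1) = 2`: either `T ≡ 1` (then `Φs = c • Φ` as before) or `T` alternates
between `0` and `2` (then `1_Φ((st)^a) = 1_Φ((st)^a s) = [T(a) = 2]` and `Φ(st) = c • Φ`, because `k + 1` is even).
-/

set_option autoImplicit false

open Finset DihedralGroup
open scoped Pointwise

namespace HodgeRepro.CosetQuad

variable {G : Type*} [Group G] [DecidableEq G]

/-! ### Row sums over the `s`-cosets -/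

omit [DecidableEq G] in
/-- `toNat ≤ 1`. -/
theorem toNat_le_one_dih (b : Bool) : b.toNat ≤ 1 := by cases b <;> decide

/-- The row sum `S(x) = 1_Φ(x) + 1_Φ(xs)`. -/
def rowS (Φ : Finset G) (s x : G) : ℕ := (decide (x ∈ Φ)).toNat + (decide (x * s ∈ Φ)).toNat

/-- `S ≤ 2`. -/
theorem rowS_le_two (Φ : Finset G) (s x : G) : rowS Φ s x ≤ 2 := by
  unfold rowS
  have := toNat_le_one_dih (decide (x ∈ Φ))
  have := toNat_le_one_dih (decide (x * s ∈ Φ))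
  omega

/-- `S(xs) = S(x)`. -/
theorem rowS_mul_s (Φ : Finset G) {s : G} (hs : s * s = 1) (x : G) : rowS Φ s (x * s) = rowS Φ s x := by
  unfold rowS
  rw [mul_assoc, hs, mul_one, add_comm]

/-- The local `SumTwo` of the dihedral quadruple at `x`: `S(x) + S(xt) = 2`. -/
theorem rowS_add_rowS_mul_t {Φ : Finset G} {s t : G} (hs : s * s = 1) (ht : t * t = 1)
    (hst : SumTwo ![Φ, rmul Φ s, rmul Φ t, rmul Φ (s * t)]) (x : G) :
    rowS Φ s x + rowS Φ s (x * t) = 2 := by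
  have h := hst x
  have hv : (univ.filter fun j : Fin 4 => x ∈ ![Φ, rmul Φ s, rmul Φ t, rmul Φ (s * t)] j) =
      univ.filter fun j : Fin 4 => ![decide (x ∈ Φ), decide (x * s ∈ Φ), decide (x * t ∈ Φ),
        decide (x * t * s ∈ Φ)] j = true := by
    apply Finset.filter_congr
    intro j _
    fin_cases j
    · show x ∈ Φ ↔ decide (x ∈ Φ) = true
      rw [decide_eq_true_iff]
    · show x ∈ rmul Φ s ↔ decide (x * s ∈ Φ) = true
      rw [decide_eq_true_iff, mem_rmul, inv_eq_of_mul_eq_one_right hs]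
    · show x ∈ rmul Φ t ↔ decide (x * t ∈ Φ) = true
      rw [decide_eq_true_iff, mem_rmul, inv_eq_of_mul_eq_one_right ht]
    · show x ∈ rmul Φ (s * t) ↔ decide (x * t * s ∈ Φ) = true
      rw [decide_eq_true_iff, mem_rmul, inv_mul_involutions hs ht, mul_assoc]
  rw [hv, card_filter_vec_eq_two_iff] at h
  unfold rowS
  omega

/-- `S(x) + S(x · st) = 2`. -/
theorem rowS_add_rowS_mul_st {Φ : Finset G} {s t : G} (hs : s * s = 1) (ht : t * t = 1)
    (hst : SumTwo ![Φ, rmul Φ s, rmul Φ t, rmul Φ (s * t)]) (x : G) :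
    rowS Φ s x + rowS Φ s (x * (s * t)) = 2 := by
  have h := rowS_add_rowS_mul_t hs ht hst (x * s)
  rwa [rowS_mul_s Φ hs, mul_assoc] at h

/-- The CM condition in row-sum form: `S(xc) + S(x) = 2`. -/
theorem rowS_mul_conj {Φ : Finset G} {c : G} (hc : IsComplexConj c) (hΦ : IsCMType c Φ) (s x : G) :
    rowS Φ s (x * c) + rowS Φ s x = 2 := by
  unfold rowS
  have e1 : decide (x * c ∈ Φ) = !decide (x ∈ Φ) := by
    rw [← decide_not]; exact decide_eq_decide.mpr (by rw [← hc.comm]; exact hΦ.conj_mem_iff x)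
  have e2 : decide (x * c * s ∈ Φ) = !decide (x * s ∈ Φ) := by
    rw [← decide_not]
    exact decide_eq_decide.mpr (by
      rw [mul_assoc, hc.comm s, ← mul_assoc, ← hc.comm (x * s)]; exact hΦ.conj_mem_iff (x * s))
  rw [e1, e2]
  have := toNat_not_add (decide (x ∈ Φ))
  have := toNat_not_add (decide (x * s ∈ Φ))
  omega

/-- Period `2` along the `⟨st⟩`-orbits: `S(x · (st)^(2m)) = S(x)`. -/
theorem rowS_mul_pow_two {Φ : Finset G} {s t : G} (hs : s * s = 1) (ht : t * t = 1)
    (hst : SumTwo ![Φ, rmul Φ s, rmul Φ t, rmul Φ (s * t)]) (x : G) (m : ℕ) :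
    rowS Φ s (x * (s * t) ^ (2 * m)) = rowS Φ s x := by
  induction m with
  | zero => rw [mul_zero, pow_zero, mul_one]
  | succ n ih =>
    have h1 := rowS_add_rowS_mul_st hs ht hst (x * (s * t) ^ (2 * n))
    have h2 := rowS_add_rowS_mul_st hs ht hst (x * (s * t) ^ (2 * n) * (s * t))
    have e : x * (s * t) ^ (2 * (n + 1)) = x * (s * t) ^ (2 * n) * (s * t) * (s * t) := by
      rw [show 2 * (n + 1) = 2 * n + 1 + 1 by ring]; simp only [pow_succ, mul_assoc]
    rw [e]
    omega

/-- `S ≡ 1` gives the conjugate pair `Φs = c • Φ`. -/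
theorem rmul_s_eq_smul_of_rowS {Φ : Finset G} {c : G} (hc : IsComplexConj c) (hΦ : IsCMType c Φ)
    {s : G} (hs : s * s = 1) (hS : ∀ x, rowS Φ s x = 1) : rmul Φ s = c • Φ := by
  ext y
  rw [mem_rmul, hc.mem_smul_iff, inv_eq_of_mul_eq_one_right hs, hΦ.conj_mem_iff]
  have h := eq_not_of_toNat_add_eq_one (hS y)
  rw [Bool.eq_iff_iff, decide_eq_true_iff', not_decide_eq_true_iff] at h
  exact h

/-- **`k` even is empty.**  For involutions `s, t` with `(st)^k = c`, `k` EVEN, every `SumTwo` quadruple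
`Φ, Φs, Φt, Φ(st)` of a CM type has `Φs = c • Φ`. -/
theorem rmul_s_eq_smul_of_even {Φ : Finset G} {c : G} (hc : IsComplexConj c) (hΦ : IsCMType c Φ)
    {s t : G} (hs : s * s = 1) (ht : t * t = 1) {k : ℕ} (hck : (s * t) ^ k = c) (hk : Even k)
    (hst : SumTwo ![Φ, rmul Φ s, rmul Φ t, rmul Φ (s * t)]) : rmul Φ s = c • Φ := by
  obtain ⟨m, hm⟩ := hk
  apply rmul_s_eq_smul_of_rowS hc hΦ hs
  intro x
  have h1 := rowS_mul_conj hc hΦ s x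
  have h2 := rowS_mul_pow_two hs ht hst x m
  rw [show 2 * m = k by omega, hck] at h2
  omega

/-! ### Below `8k`: the threshold -/

omit [DecidableEq G] in
/-- `s (st)^m = (ts)^m s` for an involution `s`. -/
theorem mul_pow_left_eq {s : G} (hs : s * s = 1) (t : G) (m : ℕ) :
    s * (s * t) ^ m = (t * s) ^ m * s := by
  induction m with
  | zero => rw [pow_zero, pow_zero, one_mul, mul_one]
  | succ n ih =>
    rw [pow_succ, ← mul_assoc, ih, pow_succ, mul_assoc, mul_assoc, ← mul_assoc s s t, hs, one_mul,
      mul_assoc t s s, hs, mul_one]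

omit [DecidableEq G] in
/-- `s (st)^m = (st)^(2k − m) s` for `m ≤ 2k` when `(st)^(2k) = 1`. -/
theorem mul_pow_eq_pow_sub {s t : G} (hs : s * s = 1) (ht : t * t = 1) {n m : ℕ}
    (hn : (s * t) ^ n = 1) (hm : m ≤ n) : s * (s * t) ^ m = (s * t) ^ (n - m) * s := by
  rw [mul_pow_left_eq hs, ← inv_mul_involutions hs ht, inv_pow]
  congr 1
  apply inv_eq_of_mul_eq_one_right
  rw [← pow_add, Nat.add_sub_cancel' hm, hn]

omit [DecidableEq G] in
/-- `(st)^b (ts) = (st)^(b−1)` for `b ≥ 1`. -/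
theorem pow_mul_ts {s t : G} (hs : s * s = 1) (ht : t * t = 1) {b : ℕ} (hb : 1 ≤ b) :
    (s * t) ^ b * (t * s) = (s * t) ^ (b - 1) := by
  obtain ⟨b', rfl⟩ : ∃ b', b = b' + 1 := ⟨b - 1, by omega⟩
  rw [Nat.add_sub_cancel, pow_succ, mul_assoc, show s * t * (t * s) = 1 by
    rw [mul_assoc, ← mul_assoc t, ht, one_mul, hs], mul_one]

omit [DecidableEq G] in
/-- `(st)^b s (ts) = (st)^(b+1) s`. -/
theorem pow_mul_s_mul_ts {s t : G} (b : ℕ) : (s * t) ^ b * s * (t * s) = (s * t) ^ (b + 1) * s := by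
  rw [pow_succ]; group

/-- In the alternating case (`S ∈ {0, 2}` along the orbit) membership is the value `2`. -/
theorem mem_iff_rowS_eq_two {Φ : Finset G} {s x : G} (h : rowS Φ s x ≠ 1) :
    (x ∈ Φ ↔ rowS Φ s x = 2) ∧ (x * s ∈ Φ ↔ rowS Φ s x = 2) := by
  unfold rowS at *
  by_cases hx : x ∈ Φ <;> by_cases hxs : x * s ∈ Φ <;> simp [hx, hxs] at h ⊢

/-- **The threshold.**  A dihedral quadruple `Φ, Φs, Φt, Φ(st)` (`s, t` involutions, `st` of order `2k`,
`k ≥ 3`, `(st)^k = c`) that is `SumTwo` without a conjugate pair forces `8k ≤ |G|`. -/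
theorem eight_mul_le_card_of_dihedralQuad [Fintype G] {k : ℕ} {c : G} (hc : IsComplexConj c) {s t : G}
    (hs : s * s = 1) (ht : t * t = 1) (hord : orderOf (s * t) = 2 * k) (hk : 3 ≤ k) (hck : (s * t) ^ k = c)
    {Φ : Finset G} (hΦ : IsCMType c Φ) (hst : SumTwo ![Φ, rmul Φ s, rmul Φ t, rmul Φ (s * t)])
    (hnc : ∀ i j : Fin 4, ![Φ, rmul Φ s, rmul Φ t, rmul Φ (s * t)] j ≠
      c • ![Φ, rmul Φ s, rmul Φ t, rmul Φ (s * t)] i) : 8 * k ≤ Fintype.card G := by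
  haveI : NeZero k := ⟨by omega⟩
  have hpow : (s * t) ^ (2 * k) = 1 := by rw [← hord]; exact pow_orderOf_eq_one _
  set ψ := dihedralRectHom k s t hs ht hpow with hψdef
  have hψ : Function.Injective ψ := dihedralRectHom_injective k hs ht hpow hord hk
  -- Lagrange: `4k ∣ |G|`
  have hdvd : 4 * k ∣ Fintype.card G := by
    have h := Subgroup.card_subgroup_dvd_card ψ.range
    rw [← Nat.card_congr (MonoidHom.ofInjective hψ).toEquiv, Nat.card_eq_fintype_card,
      Nat.card_eq_fintype_card, card_PD] at h
    exact h
  by_contra hlt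
  rw [not_le] at hlt
  have hcard : Fintype.card G = 4 * k := by
    obtain ⟨m, hm⟩ := hdvd
    have hpos : 0 < Fintype.card G := Fintype.card_pos
    have : m = 1 := by
      rcases Nat.lt_or_ge m 2 with h | h
      · interval_cases m
        · omega
        · rfl
      · have h2 : 4 * k * 2 ≤ 4 * k * m := Nat.mul_le_mul_left (4 * k) h
        omega
    rw [hm, this, mul_one]
  have hbij : Function.Bijective ψ :=
    (Fintype.bijective_iff_injective_and_card ψ).2 ⟨hψ, by rw [card_PD, hcard]⟩
  -- every element is `(st)^a` or `(st)^a s`, with `a ≥ 1` at will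
  have hsurj : ∀ x : G, ∃ a : ℕ, 1 ≤ a ∧ (x = (s * t) ^ a ∨ x = (s * t) ^ a * s) := by
    intro x
    obtain ⟨p, rfl⟩ := hbij.2 x
    have hsh : ∀ a : ℕ, (s * t) ^ a = (s * t) ^ (a + 2 * k) := fun a => by
      rw [pow_add, hpow, mul_one]
    cases p with
    | r i =>
      refine ⟨i.val + 2 * k, by omega, Or.inl ?_⟩
      rw [hψdef, dihedralRectHom_r, hsh]
    | sr i =>
      refine ⟨2 * k - i.val + 2 * k, by omega, Or.inr ?_⟩
      rw [hψdef, dihedralRectHom_sr, mul_pow_eq_pow_sub hs ht hpow (le_of_lt (ZMod.val_lt i)), hsh]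
  -- the orbit values `T(a) = S((st)^a)`
  set T : ℕ → ℕ := fun a => rowS Φ s ((s * t) ^ a) with hT
  have hT2 : ∀ a, T a ≤ 2 := fun a => rowS_le_two Φ s _
  have hTs : ∀ a, rowS Φ s ((s * t) ^ a * s) = T a := fun a => rowS_mul_s Φ hs _
  have hTsucc : ∀ a, T a + T (a + 1) = 2 := fun a => by
    have := rowS_add_rowS_mul_st hs ht hst ((s * t) ^ a)
    rwa [← pow_succ] at this
  have hTk : ∀ a, T (a + k) + T a = 2 := fun a => by
    have := rowS_mul_conj hc hΦ s ((s * t) ^ a)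
    rwa [← hck, ← pow_add] at this
  by_cases hT0 : T 0 = 1
  · -- `T ≡ 1`, hence `S ≡ 1` on `G`: the pair `(0, 1)`
    have hT1 : ∀ a, T a = 1 := by
      intro a
      induction a with
      | zero => exact hT0
      | succ n ih => have := hTsucc n; omega
    have hS : ∀ x, rowS Φ s x = 1 := by
      intro x
      obtain ⟨a, _, rfl | rfl⟩ := hsurj x
      · exact hT1 a
      · rw [hTs]; exact hT1 a
    exact hnc 0 1 (rmul_s_eq_smul_of_rowS hc hΦ hs hS)
  · -- `T` alternates between `0` and `2`: the pair `(0, 3)`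
    have hper : ∀ a, T (a + 2) = T a := fun a => by
      have h1 := hTsucc a; have h2 := hTsucc (a + 1)
      rw [show a + 1 + 1 = a + 2 by ring] at h2
      omega
    have hper2 : ∀ a m, T (a + 2 * m) = T a := by
      intro a m
      induction m with
      | zero => rw [mul_zero, add_zero]
      | succ n ih => rw [show a + 2 * (n + 1) = a + 2 * n + 2 by ring, hper, ih]
    have hne1 : ∀ a, T a ≠ 1 := by
      intro a
      rcases Nat.even_or_odd a with ⟨m, hm⟩ | ⟨m, hm⟩
      · rw [hm, ← two_mul, show 2 * m = 0 + 2 * m by ring, hper2]; exact hT0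
      · rw [hm, show 2 * m + 1 = 1 + 2 * m by ring, hper2]
        have h1 := hTsucc 0
        rw [zero_add] at h1
        have := hT2 0; have := hT2 1; omega
    have hodd : Odd k := by
      by_contra hev
      rw [Nat.not_odd_iff_even] at hev
      obtain ⟨m, hm⟩ := hev
      have h1 := hTk 0
      rw [zero_add, hm, ← two_mul, show 2 * m = 0 + 2 * m by ring, hper2] at h1
      have := hne1 0; omega
    obtain ⟨m, hm⟩ := hodd
    have hkey : ∀ b, 1 ≤ b → T (b - 1) = T (b + k) := by
      intro b hb
      rw [show b + k = (b - 1) + 2 * (m + 1) by omega, hper2]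
    have hkey' : ∀ b, T (b + 1) = T (b + k) := by
      intro b
      rw [show b + k = (b + 1) + 2 * m by omega, hper2]
    -- `Φ(st) = c • Φ`
    apply hnc 0 3
    show rmul Φ (s * t) = c • Φ
    ext y
    rw [mem_rmul, hc.mem_smul_iff, inv_mul_involutions hs ht, hc.comm]
    obtain ⟨b, hb, rfl | rfl⟩ := hsurj y
    · rw [pow_mul_ts hs ht hb, ← hck, ← pow_add]
      have e1 := (mem_iff_rowS_eq_two (s := s) (hne1 (b - 1))).1
      have e2 := (mem_iff_rowS_eq_two (s := s) (hne1 (b + k))).1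
      rw [e1, e2]
      show T (b - 1) = 2 ↔ T (b + k) = 2
      rw [hkey b hb]
    · rw [pow_mul_s_mul_ts, mul_assoc ((s * t) ^ b) s c, ← hc.comm, ← mul_assoc, ← hck, ← pow_add]
      have e1 := (mem_iff_rowS_eq_two (s := s) (hne1 (b + 1))).2
      have e2 := (mem_iff_rowS_eq_two (s := s) (hne1 (b + k))).2
      rw [e1, e2]
      show T (b + 1) = 2 ↔ T (b + k) = 2
      rw [hkey' b]

/-- **The dihedral criterion.**  Involutions `s, t` with `st` of order `2k` (`k ≥ 3` odd) and `(st)^k = c`: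
a CM type whose twists `Φ, Φs, Φt, Φ(st)` are `SumTwo` without a conjugate pair exists IFF `8k ≤ |G|`. -/
theorem exists_dihedralQuad_iff [Fintype G] {k : ℕ} {c : G} (hc : IsComplexConj c) {s t : G}
    (hs : s * s = 1) (ht : t * t = 1) (hord : orderOf (s * t) = 2 * k) (hk : 3 ≤ k) (hodd : Odd k)
    (hck : (s * t) ^ k = c) :
    (∃ Φ : Finset G, IsCMType c Φ ∧ SumTwo ![Φ, rmul Φ s, rmul Φ t, rmul Φ (s * t)] ∧
      ∀ i j : Fin 4, ![Φ, rmul Φ s, rmul Φ t, rmul Φ (s * t)] j ≠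
        c • ![Φ, rmul Φ s, rmul Φ t, rmul Φ (s * t)] i) ↔ 8 * k ≤ Fintype.card G :=
  ⟨fun ⟨_, hΦ, hst, hnc⟩ => eight_mul_le_card_of_dihedralQuad hc hs ht hord hk hck hΦ hst hnc,
    fun h => exists_dihedralQuad hc hs ht hord hk hodd hck h⟩

end HodgeRepro.CosetQuad
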